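import Summits.PneNP.PneNP.Theorems.ChebyshevTracialDesignFreeBinning
import Literature.Computation.Certificates.SemidefiniteComplementarity
import HarnessLib

/-!
# Cell pnp-psdrank, route `ChebyshevTracialDesign`: CG_1 ⟹ the crux on the AMPLITUDE CLASS `𝒜₁ = {f·B Bᵀ : deg B = 1}` at EVERY dimension —
# the dimension disappears into the Frobenius mass of the coefficients (crux `TracialDecayExp20`, stmt-PneNP-19878)

Brick 106 (prover g19; MEMO-21 §3(b) first bullet / §5(v) last sentence, MEMO-22 §1). The r-free ladder of MEMO-21 §3(b) rests on the remark that
«conditional Grigoriev positivity at degree 1» — (CG_1) «`F^f_M := (Σ_U W(U,M) f(U) x_px_q)_{p,q} ⪯ ε_M·I` with `Σ_M (ε_M)₊` small» — prices the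
whole amplitude class `X_U = f(U)·B_UB_Uᵀ`, `B_U = Σ_p x_p(U)·β_p` (`β_p ∈ ℝ^{r×m}`, ANY `r`, `m`), against ANY psd matching side, with the dimension `r`
entering only through the Frobenius mass `Σ_p‖β_p‖_F²`. This file is that remark in the kernel, for an ARBITRARY weight `W` (pure algebra):
* §1 `trace_mul_transpose_mul_gram` — `tr(B Bᵀ·SᵀS) = Σ_{a,j} (S B)_{aj}²` (the SOS step), `mul_sum_smul_apply` — `(S·Σ_p x_pβ_p)_{aj} = Σ_p x_p (Sβ_p)_{aj}`;
* §2 **`value_amplitudeOne_le_of_CG1`** — if `Σ_U W(U,M) f(U)(Σ_p g_p x_p)² ≤ ε_M·Σ_p g_p²` for every `M` and every `g : Fin n → ℝ`, then for every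
  psd matching side `Y`: `Σ_{U,M} W(U,M) f(U)·tr(B_UB_UᵀY_M) ≤ Σ_M ε_M·Σ_p tr(β_pᵀY_Mβ_p)`;
* §2 **`value_amplitudeOne_le_of_CG1_contraction`** — if moreover `Y_M ⪯ I`: `≤ (Σ_M (ε_M)₊)·Σ_p tr(β_pβ_pᵀ)` — NO `r` anywhere else. (For a
  degree-1 Gram contraction `B_UB_Uᵀ ⪯ I` on the `t`-slice, `Σ_p‖β_p‖_F² ≤ r·n(n−1)/(t(n−t)) ≤ 8r` by averaging over `U` — MEMO-21 §5(v); not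
  needed here.)
So the first rung above NTF is, by name: (CG_1) ⟹ crux on `𝒜₁` (this file); (CG_1) ⟺ (CG_1') up to `3n⁴(Σ|w|)√P_{D−4}` on cube test vectors
(bricks 99–101); (CG_1') anatomised in bricks 102–105. [cite: GriblingDelaatLaurent2019, §5] [cite: Rothvoss2017, §2 (PDF p. 6)]
[cite: BlekhermanParriloThomas2012, App. A Prop. A.1 (6)]
Stature: support/instrument (kernel lane, no defs, axioms standard). WHAT THIS IS NOT: no proof of (CG_1), no proof or refutation of
`TracialDecayExp20`, nothing on psd rank of P_PM(K_n), no P-vs-NP content. Supports stmt-PneNP-19878.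
-/

set_option linter.dupNamespace false -- `Summit.PneNP.PneNP.…`: summit = sub-problem (D-0017)

noncomputable section

namespace Summit.PneNP.PneNP.Theorems.ChebyshevTracialDesignAmplitudeOneReduction

open Finset Matrix Literature.Barriers.PneNP Literature.Combinatorics.Optimization
open Literature.Computation.Certificates.SemidefiniteComplementarity (exists_eq_conjTranspose_mul_self)
open Summit.PneNP.PneNP.Theorems.ChebyshevTracialDesignFreeBinning (trace_mul_nonneg_of_psd)

variable {n : ℕ}

/-! ### §1 Two pieces of matrix algebra -/

/-- **The SOS step**: `tr(B Bᵀ · SᵀS) = Σ_{a,j} (S B)_{aj}²`. [folklore] -/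
theorem trace_mul_transpose_mul_gram {r m k : ℕ} (B : Matrix (Fin r) (Fin m) ℝ) (S : Matrix (Fin k) (Fin r) ℝ) :
    (B * Bᵀ * (Sᵀ * S)).trace = ∑ a, ∑ j, (S * B) a j ^ 2 := by
  have h1 : (B * Bᵀ * (Sᵀ * S)).trace = ((S * B) * (S * B)ᵀ).trace := by
    rw [Matrix.transpose_mul, ← Matrix.mul_assoc, Matrix.trace_mul_comm, ← Matrix.mul_assoc, ← Matrix.mul_assoc, Matrix.mul_assoc]
  rw [h1]
  simp only [Matrix.trace, Matrix.diag_apply, Matrix.mul_apply, Matrix.transpose_apply]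
  exact sum_congr rfl fun a _ => sum_congr rfl fun j _ => by ring

/-- `(S · Σ_p c_p β_p)_{aj} = Σ_p c_p (S β_p)_{aj}`. [folklore] -/
theorem mul_sum_smul_apply {r m k : ℕ} (S : Matrix (Fin k) (Fin r) ℝ) (c : Fin n → ℝ) (β : Fin n → Matrix (Fin r) (Fin m) ℝ) (a : Fin k) (j : Fin m) :
    (S * ∑ p, c p • β p) a j = ∑ p, c p * (S * β p) a j := by
  rw [Matrix.mul_apply]
  calc ∑ k, S a k * (∑ p, c p • β p) k j = ∑ k, ∑ p, S a k * (c p * β p k j) := by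
        refine sum_congr rfl fun k _ => ?_
        rw [Matrix.sum_apply, Finset.mul_sum]
        exact sum_congr rfl fun p _ => by rw [Matrix.smul_apply, smul_eq_mul]
    _ = ∑ p, ∑ k, S a k * (c p * β p k j) := sum_comm
    _ = ∑ p, c p * (S * β p) a j := by
        refine sum_congr rfl fun p _ => ?_
        rw [Matrix.mul_apply, Finset.mul_sum]
        exact sum_congr rfl fun k _ => by ring

/-! ### §2 CG_1 prices the amplitude class at every dimension -/

/-- **CG_1 ⟹ THE CRUX ON `𝒜₁`, for any weight.** Let `W` be any weight, `f` any mask, `B_U = Σ_p x_p(U)·β_p` a homogeneous degree-one cut factor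
(`β_p ∈ ℝ^{r×m}`), `Y` any psd matching side, and suppose the degree-one conditional positivity
`Σ_U W(U,M) f(U)·(Σ_p g_p x_p(U))² ≤ ε_M·Σ_p g_p²` for every `M` and every `g : Fin n → ℝ`. Then
`Σ_{U,M} W(U,M)·f(U)·tr(B_U B_Uᵀ Y_M) ≤ Σ_M ε_M·Σ_p tr(β_pᵀ Y_M β_p)`. [cite: GriblingDelaatLaurent2019, §5] [cite: Rothvoss2017, §2 (PDF p. 6)] -/
theorem value_amplitudeOne_le_of_CG1 {r m : ℕ} (W : OddSet n → PMatch n → ℝ) (f : OddSet n → ℝ)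
    (β : Fin n → Matrix (Fin r) (Fin m) ℝ) (Y : PMatch n → Matrix (Fin r) (Fin r) ℝ) (hY : ∀ M, (Y M).PosSemidef) (ε : PMatch n → ℝ)
    (hCG : ∀ (M : PMatch n) (g : Fin n → ℝ),
      ∑ U : OddSet n, W U M * (f U * (∑ p, g p * (if p ∈ U.1 then (1 : ℝ) else 0)) ^ 2) ≤ ε M * ∑ p, g p ^ 2) :
    ∑ U : OddSet n, ∑ M : PMatch n, W U M *
        (f U * ((∑ p, (if p ∈ U.1 then (1 : ℝ) else 0) • β p) * (∑ p, (if p ∈ U.1 then (1 : ℝ) else 0) • β p)ᵀ * Y M).trace) ≤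
      ∑ M : PMatch n, ε M * ∑ p, ((β p)ᵀ * Y M * β p).trace := by
  rw [sum_comm]
  refine sum_le_sum fun M _ => ?_
  -- Gram factor of `Y_M`
  obtain ⟨S, hS⟩ := exists_eq_conjTranspose_mul_self (hY M)
  have hS' : Y M = Sᵀ * S := by rw [hS, conjTranspose_eq_transpose_of_trivial]
  set x : OddSet n → Fin n → ℝ := fun U p => if p ∈ U.1 then (1 : ℝ) else 0 with hx
  -- the value at `M` as a sum of `r·m` scalar degree-one forms
  have hval : ∀ U : OddSet n, ((∑ p, x U p • β p) * (∑ p, x U p • β p)ᵀ * Y M).trace =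
      ∑ a, ∑ j, (∑ p, x U p * (S * β p) a j) ^ 2 := fun U => by
    rw [hS', trace_mul_transpose_mul_gram]
    exact sum_congr rfl fun a _ => sum_congr rfl fun j _ => by rw [mul_sum_smul_apply]
  have hlhs : ∑ U : OddSet n, W U M * (f U * ((∑ p, x U p • β p) * (∑ p, x U p • β p)ᵀ * Y M).trace) =
      ∑ a, ∑ j, ∑ U : OddSet n, W U M * (f U * (∑ p, (S * β p) a j * x U p) ^ 2) := by
    calc ∑ U : OddSet n, W U M * (f U * ((∑ p, x U p • β p) * (∑ p, x U p • β p)ᵀ * Y M).trace)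
        = ∑ U : OddSet n, ∑ a, ∑ j, W U M * (f U * (∑ p, (S * β p) a j * x U p) ^ 2) := by
          refine sum_congr rfl fun U _ => ?_
          rw [hval U, mul_sum, mul_sum]
          refine sum_congr rfl fun a _ => ?_
          rw [mul_sum, mul_sum]
          refine sum_congr rfl fun j _ => ?_
          congr 2
          exact congrArg (· ^ 2) (sum_congr rfl fun p _ => mul_comm _ _)
      _ = ∑ a, ∑ U : OddSet n, ∑ j, W U M * (f U * (∑ p, (S * β p) a j * x U p) ^ 2) := sum_comm
      _ = ∑ a, ∑ j, ∑ U : OddSet n, W U M * (f U * (∑ p, (S * β p) a j * x U p) ^ 2) := sum_congr rfl fun a _ => sum_comm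
  -- the right-hand side at `M`
  have hrhs : ∑ p, ((β p)ᵀ * Y M * β p).trace = ∑ a, ∑ j, ∑ p, (S * β p) a j ^ 2 := by
    calc ∑ p, ((β p)ᵀ * Y M * β p).trace = ∑ p, ∑ a, ∑ j, (S * β p) a j ^ 2 := by
          refine sum_congr rfl fun p _ => ?_
          have : ((β p)ᵀ * Y M * β p).trace = ((S * β p)ᵀ * (S * β p)).trace := by
            rw [hS', Matrix.transpose_mul, Matrix.mul_assoc, Matrix.mul_assoc, ← Matrix.mul_assoc (β p)ᵀ]
          rw [this, Matrix.trace_mul_comm]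
          simp only [Matrix.trace, Matrix.diag_apply, Matrix.mul_apply, Matrix.transpose_apply]
          exact sum_congr rfl fun a _ => sum_congr rfl fun j _ => by ring
      _ = ∑ a, ∑ p, ∑ j, (S * β p) a j ^ 2 := sum_comm
      _ = ∑ a, ∑ j, ∑ p, (S * β p) a j ^ 2 := sum_congr rfl fun a _ => sum_comm
  rw [hlhs, hrhs, mul_sum]
  refine sum_le_sum fun a _ => ?_
  rw [mul_sum]
  refine sum_le_sum fun j _ => ?_
  exact hCG M (fun p => (S * β p) a j)

/-- `tr(βᵀ Y β) ≤ tr(β βᵀ)` for a psd contraction `0 ⪯ Y ⪯ I`. [folklore] -/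
theorem trace_transpose_mul_mul_le {r m : ℕ} (β : Matrix (Fin r) (Fin m) ℝ) {Y : Matrix (Fin r) (Fin r) ℝ} (hY1 : (1 - Y).PosSemidef) :
    ((β)ᵀ * Y * β).trace ≤ (β * βᵀ).trace := by
  have hG : (β * βᵀ).PosSemidef := by
    simpa [conjTranspose_eq_transpose_of_trivial] using Matrix.posSemidef_self_mul_conjTranspose β
  have h := trace_mul_nonneg_of_psd hG hY1
  rw [Matrix.mul_sub, Matrix.mul_one, Matrix.trace_sub] at h
  have e : ((β)ᵀ * Y * β).trace = (β * βᵀ * Y).trace := by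
    rw [Matrix.mul_assoc, Matrix.trace_mul_comm, Matrix.mul_assoc, Matrix.trace_mul_comm Y, Matrix.mul_assoc]
  rw [e]
  linarith

/-- **CG_1 ⟹ THE CRUX ON `𝒜₁` AT EVERY DIMENSION (contraction form).** Under the hypotheses of `value_amplitudeOne_le_of_CG1`, if in addition
`Y_M ⪯ I` for all `M`, then `Σ_{U,M} W(U,M) f(U) tr(B_UB_UᵀY_M) ≤ (Σ_M (ε_M)₊)·Σ_p tr(β_pβ_pᵀ)`: the dimension `r` has disappeared into the
Frobenius mass of the degree-one coefficients. [cite: GriblingDelaatLaurent2019, §5] [cite: Rothvoss2017, §2 (PDF p. 6)] -/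
theorem value_amplitudeOne_le_of_CG1_contraction {r m : ℕ} (W : OddSet n → PMatch n → ℝ) (f : OddSet n → ℝ)
    (β : Fin n → Matrix (Fin r) (Fin m) ℝ) (Y : PMatch n → Matrix (Fin r) (Fin r) ℝ)
    (hY : ∀ M, (Y M).PosSemidef ∧ (1 - Y M).PosSemidef) (ε : PMatch n → ℝ)
    (hCG : ∀ (M : PMatch n) (g : Fin n → ℝ),
      ∑ U : OddSet n, W U M * (f U * (∑ p, g p * (if p ∈ U.1 then (1 : ℝ) else 0)) ^ 2) ≤ ε M * ∑ p, g p ^ 2) :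
    ∑ U : OddSet n, ∑ M : PMatch n, W U M *
        (f U * ((∑ p, (if p ∈ U.1 then (1 : ℝ) else 0) • β p) * (∑ p, (if p ∈ U.1 then (1 : ℝ) else 0) • β p)ᵀ * Y M).trace) ≤
      (∑ M : PMatch n, max (ε M) 0) * ∑ p, (β p * (β p)ᵀ).trace := by
  -- CG_1 with `ε` replaced by `ε₊`
  have hCG' : ∀ (M : PMatch n) (g : Fin n → ℝ),
      ∑ U : OddSet n, W U M * (f U * (∑ p, g p * (if p ∈ U.1 then (1 : ℝ) else 0)) ^ 2) ≤ max (ε M) 0 * ∑ p, g p ^ 2 :=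
    fun M g => (hCG M g).trans (mul_le_mul_of_nonneg_right (le_max_left _ _) (sum_nonneg fun p _ => sq_nonneg _))
  refine (value_amplitudeOne_le_of_CG1 W f β Y (fun M => (hY M).1) (fun M => max (ε M) 0) hCG').trans ?_
  rw [sum_mul]
  refine sum_le_sum fun M _ => mul_le_mul_of_nonneg_left (sum_le_sum fun p _ => trace_transpose_mul_mul_le (β p) (hY M).2) (le_max_right _ _)

end Summit.PneNP.PneNP.Theorems.ChebyshevTracialDesignAmplitudeOneReduction
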